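import Mathlib
import HarnessLib
import Literature.Combinatorics.Additive.OlsonSumsInGroups
import Literature.Combinatorics.Additive.Kneser

/-!
# Kemperman's pointed-subgroup theorem for the product `A·B` in an arbitrary group
# (Kemperman 1956; DeVos 2013, Theorem 1.6)

Topic `Literature/Combinatorics/Additive`.  Cell `mm-stpp` (D-0046), seat `mm-stpp-lit` (gen 14);
companion of `OlsonSumsInGroups.lean` (Kemperman's transformation, Olson 1984 Thm 3) and of
`KempermanScherk.lean` (Kemperman's unique-representation theorem).  Everything in this file is
PROVED (no named facts), for an ARBITRARY group `G` written multiplicatively, with additive twins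
generated by `@[to_additive]`.

**The theorem** (M. DeVos, *The structure of critical product sets*, arXiv:1301.0096, Theorem 1.6,
attributed there to J. H. B. Kemperman, *On complexes in a semigroup*, Indag. Math. 18 (1956)):

  "If `A, B ⊆ G` are finite and nonempty and `a ∈ A` and `b ∈ B`, there exists `H ≤ G` so that
   • `δ(A,B) ≤ |H|`   • `aHb ⊆ AB`."

Here `δ(A,B) = |A| + |B| − |AB|` is the deficiency (DeVos §1.1), so the first item reads
`|A| + |B| ≤ |AB| + |H|`; the subgroup `H` is finite because `aHb ⊆ AB`.  Kernel statement:
`kemperman_pointed_subgroup` (and `kemperman_pointed_addSubgroup`).  In words: through EVERY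
element `ab` of the product set passes a (two-sided translate of a) finite subgroup lying inside
`AB` whose order pays for the whole deficiency.  For torsion-free groups (no non-trivial finite
subgroup) this is Kemperman's inequality `|AB| ≥ |A| + |B| − 1` (Brailovsky–Freiman 1990, (1.1):
"It is known [Ke] that … |KM| ≥ |K| + |M| − 1"), which Mathlib has independently as
`Finset.card_add_card_sub_one_le_card_mul`-type statements in
`Mathlib/Combinatorics/Additive/CauchyDavenport.lean` (`Finset.min_le_card_mul`); we do not restate
those, but we record the dichotomy they come from (`card_add_card_le_card_mul_add_one_or_nontrivial`).

**Proof formalized here** (Kemperman's original is paywalled and not held — acquisition request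
acq-13692; DeVos derives Theorem 1.6 from his 78-page structure theorem, Corollary `cor_basic`.
The argument below is this file's own reconstruction from KEMPERMAN'S TRANSFORMATION, the device
of Kemperman 1956 that Olson 1984 Thm 3 isolates — tree `Olson.exists_kemperman_transform`; DeVos
p. 9: "The first usage of this precise transformation we know of appears in a paper of Kemperman
[kemperman1]"):

1. Normalise to `1 ∈ A ∩ B` (`A ↦ a⁻¹A`, `B ↦ Bb⁻¹`; then `aHb ⊆ AB` iff `H ⊆ (a⁻¹A)(Bb⁻¹)`).
2. *Pointed transformation* (`exists_pointed_transform`): for `d ∈ A ∩ B` the two Kemperman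
   transforms `(A ∪ Ad, {b ∈ B : db ∈ B})` and `({a ∈ A : ad ∈ A}, B ∪ dB)` BOTH keep the base point
   `1` in both sets (this is where `d ∈ A ∩ B`, rather than Olson's `d ∈ A⁻¹A ∩ BB⁻¹`, is used),
   keep the product inside `AB`, and one of them does not lower `|A| + |B|` (sizes
   `|A| + |B| ± (p − q)` with `p = |Ad ∖ A|`, `q = |dB ∖ B|`, tree
   `Olson.card_union_mulRight_add_card_filter` / `…mulLeft…`).
3. Iterate while some `d ∈ A ∩ B` moves `A` on the right or `B` on the left
   (`exists_pointed_terminal_pair`; the lexicographic potential `(|A| + |B|, |A|)` is bounded by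
   `|AB|` exactly as in tree `Olson.exists_terminal_pair`).
4. At a terminal pointed pair `(E, F)`: `D := E ∩ F` satisfies `ED ⊆ E` and `DF ⊆ F`, hence is
   closed under multiplication and (finite, by counting `E·d = E ∋ 1`) under inversion — a finite
   subgroup (`exists_subgroup_coe_eq_inter`); and `D ⊆ F = 1·F ⊆ EF ⊆ AB`, while
   `|AB| ≥ |EF| ≥ |E ∪ F| = |E| + |F| − |D| ≥ |A| + |B| − |D|` (`union_subset_mul`).

Also recorded: the ABELIAN refinement in which `H` can be taken to be the stabilizer `Stab(AB)`
itself, uniformly in the base point (`kemperman_pointed_mulStab`, from the tree's Kneser theorem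
`card_add_card_le_card_mul_add_card_mulStab`, `Kneser.lean`) — the form suggested in the gen-13
hand-off; and the dichotomy "`|AB| ≥ |A| + |B| − 1` or a NON-TRIVIAL finite coset `aHb ⊆ AB`
with `|H| ≥ δ(A,B)`" (`card_add_card_le_card_mul_add_one_or_nontrivial`).

NOT FORMALIZED: DeVos's uniform version (Corollary `cor_basic`: one `H` serving every `y ∈ AB` up
to conjugation — needs his structure theorem); Kemperman 1956's semigroup setting (cancellative
semigroups; the argument above uses inverses only through bijectivity of translations, but we state
groups only).  `-- TODO(general form): cancellative semigroups.`
Census-silent for the cell `mm-stpp` (LIT-INDEX §11 (f): "Kemperman-1956-subgroup form ABSENT" —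
now present).

## References
* M. DeVos, *The structure of critical product sets*, arXiv:1301.0096 (2013), Theorem 1.6 (p. 5
  of the held text `paper:arxiv-1301.0096`, read 2026-08-28) [cite: DeVos2013, Thm 1.6].
* J. H. B. Kemperman, *On complexes in a semigroup*, Indag. Math. 18 (1956) 247–254 — the theorem
  and the transformation (not held; acq-13692) [cite: Kemperman1956].
* J. E. Olson, *On the sum of two sets in a group*, J. Number Theory 18 (1984) 110–120, Thm 3 (the
  transformation; tree `OlsonSumsInGroups.lean`) [cite: Olson1984, Thm 3].
* L. V. Brailovsky, G. A. Freiman, *On a product of finite subsets in a torsion-free group*,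
  J. Algebra 130 (1990), (1.1) (held `paper:doi-10-1016-0021-8693-90-90093-4`, p. 2)
  [cite: BrailovskyFreiman1990, (1.1)].
* T. Tao, V. Vu, *Additive Combinatorics* (2006), Thm 5.5 (Kneser; tree `Kneser.lean`)
  [cite: TaoVu2006, Thm 5.5].
-/

namespace Literature.Combinatorics.Additive

open Finset
open scoped Pointwise

variable {G : Type*} [Group G] [DecidableEq G]

namespace KempermanPointed

/-! ### Step 2 — the pointed Kemperman transformation -/

/-- **Kemperman's transformation, pointed form.**  If `1 ∈ A ∩ B` and `d ∈ A ∩ B` moves `A` on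
the right or `B` on the left (`Ad ⊄ A` or `dB ⊄ B`), then one of the two Kemperman transforms
`(A ∪ Ad, {b ∈ B : db ∈ B})`, `({a ∈ A : ad ∈ A}, B ∪ dB)` is a pair `(A₁, B₁)` with `1 ∈ A₁ ∩ B₁`,
`A₁B₁ ⊆ AB`, and `(|A₁| + |B₁|, |A₁|)` lexicographically above `(|A| + |B|, |A|)` (Olson 1984 Thm 3
with `d ∈ A ∩ B ⊆ A⁻¹A ∩ BB⁻¹`; the base point survives because `d·1 = d ∈ B`, `1·d = d ∈ A`).
[cite: Olson1984, Thm 3] [cite: Kemperman1956] -/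
@[to_additive exists_pointed_addTransform /-- Additive-notation version of the pointed Kemperman
transformation (statement and sources as for the multiplicative declaration; Olson 1984 Thm 3,
Kemperman 1956). -/]
theorem exists_pointed_transform {A B : Finset G} {d : G} (hdA : d ∈ A) (hdB : d ∈ B)
    (h1A : (1 : G) ∈ A) (h1B : (1 : G) ∈ B)
    (hne : (∃ a ∈ A, a * d ∉ A) ∨ (∃ b ∈ B, d * b ∉ B)) :
    ∃ A₁ B₁ : Finset G, (1 : G) ∈ A₁ ∧ (1 : G) ∈ B₁ ∧ A₁ * B₁ ⊆ A * B ∧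
      ((#A₁ + #B₁ = #A + #B ∧ #A < #A₁) ∨ #A + #B < #A₁ + #B₁) := by
  -- the two candidate pairs
  set A₁ := A ∪ A.image (· * d) with hA₁
  set B₁ := B.filter (fun b => d * b ∈ B) with hB₁
  set A₂ := A.filter (fun a => a * d ∈ A) with hA₂
  set B₂ := B ∪ B.image (d * ·) with hB₂
  have hcA := Olson.card_union_mulRight_add_card_filter A d
  have hcB := Olson.card_union_mulLeft_add_card_filter B d
  rw [← hA₁, ← hA₂] at hcA
  rw [← hB₂, ← hB₁] at hcB
  -- the base point survives in all four sets
  have h1A₁ : (1 : G) ∈ A₁ := mem_union_left _ h1A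
  have h1B₁ : (1 : G) ∈ B₁ := mem_filter.2 ⟨h1B, by rwa [mul_one]⟩
  have h1A₂ : (1 : G) ∈ A₂ := mem_filter.2 ⟨h1A, by rwa [one_mul]⟩
  have h1B₂ : (1 : G) ∈ B₂ := mem_union_left _ h1B
  -- `p > 0` or `q > 0`
  have hA₂le : #A₂ ≤ #A := card_filter_le _ _
  have hB₁le : #B₁ ≤ #B := card_filter_le _ _
  have hpq : #A₂ < #A ∨ #B₁ < #B := by
    rcases hne with ⟨a, ha, had⟩ | ⟨b, hb, hdb⟩
    · exact Or.inl (card_lt_card ((filter_ssubset).2 ⟨a, ha, had⟩))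
    · exact Or.inr (card_lt_card ((filter_ssubset).2 ⟨b, hb, hdb⟩))
  -- compare `p = #A - #A₂` with `q = #B - #B₁`
  by_cases hcase : #B - #B₁ ≤ #A - #A₂
  · refine ⟨A₁, B₁, h1A₁, h1B₁, Olson.union_mulRight_mul_filter_subset A B d, ?_⟩
    omega
  · refine ⟨A₂, B₂, h1A₂, h1B₂, Olson.filter_mul_union_mulLeft_subset A B d, Or.inr ?_⟩
    omega

/-! ### Step 3 — iterating to a terminal pointed pair -/

/-- **Iterating the pointed transformation.**  From finite `A, B` with `1 ∈ A ∩ B` one reaches a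
pair `(E, F)` with `1 ∈ E ∩ F`, `EF ⊆ AB`, `|E| + |F| ≥ |A| + |B|`, such that every `d ∈ E ∩ F`
satisfies `Ed ⊆ E` and `dF ⊆ F` (the sequence terminates since `(|E| + |F|, |E|)` increases
lexicographically and both coordinates are bounded by `|AB|`, as in Olson 1984 §3).
[cite: Olson1984, Thm 2 (proof, §3)] [cite: Kemperman1956] -/
@[to_additive exists_pointed_addTerminal_pair /-- Additive-notation version (statement and sources
as for the multiplicative declaration; Olson 1984 §3, Kemperman 1956). -/]
theorem exists_pointed_terminal_pair (A B : Finset G) (h1A : (1 : G) ∈ A) (h1B : (1 : G) ∈ B) :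
    ∃ E F : Finset G, (1 : G) ∈ E ∧ (1 : G) ∈ F ∧ E * F ⊆ A * B ∧ #A + #B ≤ #E + #F ∧
      (∀ d ∈ E, d ∈ F → (∀ e ∈ E, e * d ∈ E) ∧ (∀ f ∈ F, d * f ∈ F)) := by
  -- potential: `k = 2M + 1 - (#E + #F)`, then `j = M - #E`, with `M = #(A B)`
  set M := #(A * B) with hM
  have key : ∀ k j : ℕ, ∀ E F : Finset G, (1 : G) ∈ E → (1 : G) ∈ F → E * F ⊆ A * B →
      2 * M + 1 - (#E + #F) = k → M - #E = j →
      ∃ E' F' : Finset G, (1 : G) ∈ E' ∧ (1 : G) ∈ F' ∧ E' * F' ⊆ A * B ∧ #E + #F ≤ #E' + #F' ∧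
        (∀ d ∈ E', d ∈ F' → (∀ e ∈ E', e * d ∈ E') ∧ (∀ f ∈ F', d * f ∈ F')) := by
    intro k
    induction k using Nat.strong_induction_on with
    | _ k ihk =>
    intro j
    induction j using Nat.strong_induction_on with
    | _ j ihj =>
    intro E F hE hF hEF hk hj
    by_cases hterm : ∀ d ∈ E, d ∈ F → (∀ e ∈ E, e * d ∈ E) ∧ (∀ f ∈ F, d * f ∈ F)
    · exact ⟨E, F, hE, hF, hEF, le_rfl, hterm⟩
    · have hmove : ∃ d ∈ E, d ∈ F ∧ ((∃ e ∈ E, e * d ∉ E) ∨ (∃ f ∈ F, d * f ∉ F)) := by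
        by_contra hcon
        apply hterm
        intro d hdE hdF
        by_contra hbad
        apply hcon
        refine ⟨d, hdE, hdF, ?_⟩
        by_contra hno
        apply hbad
        constructor
        · intro e he
          by_contra h
          exact hno (Or.inl ⟨e, he, h⟩)
        · intro f hf
          by_contra h
          exact hno (Or.inr ⟨f, hf, h⟩)
      obtain ⟨d, hdE, hdF, hne⟩ := hmove
      obtain ⟨E₁, F₁, hE₁, hF₁, hsub, hcard⟩ := exists_pointed_transform hdE hdF hE hF hne
      have hsub' : E₁ * F₁ ⊆ A * B := hsub.trans hEF
      -- sizes stay below `M`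
      have hE₁M : #E₁ ≤ M :=
        (card_le_card_mul_right ⟨1, hF₁⟩).trans (card_le_card hsub')
      have hF₁M : #F₁ ≤ M :=
        (card_le_card_mul_left ⟨1, hE₁⟩).trans (card_le_card hsub')
      have hEM : #E ≤ M := (card_le_card_mul_right ⟨1, hF⟩).trans (card_le_card hEF)
      rcases hcard with ⟨hsum, hlt⟩ | hsum
      · -- same `k`, smaller `j`
        obtain ⟨E', F', hE', hF', hsub'', hcard', hterm'⟩ :=
          ihj (M - #E₁) (by omega) E₁ F₁ hE₁ hF₁ hsub' (by omega) rfl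
        exact ⟨E', F', hE', hF', hsub'', by omega, hterm'⟩
      · -- smaller `k`
        obtain ⟨E', F', hE', hF', hsub'', hcard', hterm'⟩ :=
          ihk (2 * M + 1 - (#E₁ + #F₁)) (by omega) (M - #E₁) E₁ F₁ hE₁ hF₁ hsub' rfl rfl
        exact ⟨E', F', hE', hF', hsub'', by omega, hterm'⟩
  exact key _ _ A B h1A h1B subset_rfl rfl rfl

/-! ### Step 4 — the terminal intersection is a finite subgroup inside `AB` -/

/-- If `1 ∈ E` and `E·d ⊆ E` for a finite set `E`, then right translation by `d` permutes `E`;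
in particular `d⁻¹ ∈ E`. [folklore] -/
@[to_additive]
private theorem inv_mem_of_forall_mul_mem_right {E : Finset G} {d : G} (h1 : (1 : G) ∈ E)
    (h : ∀ e ∈ E, e * d ∈ E) : d⁻¹ ∈ E := by
  have himg : E.image (· * d) = E := by
    apply eq_of_subset_of_card_le
    · intro x hx
      obtain ⟨e, he, rfl⟩ := mem_image.1 hx
      exact h e he
    · rw [card_image_of_injective _ (mul_left_injective d)]
  have h1' : (1 : G) ∈ E.image (· * d) := by rw [himg]; exact h1
  obtain ⟨e, he, hed⟩ := mem_image.1 h1'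
  have : e = d⁻¹ := eq_inv_of_mul_eq_one_left hed
  rw [← this]
  exact he

/-- If `1 ∈ F` and `d·F ⊆ F` for a finite set `F`, then left translation by `d` permutes `F`;
in particular `d⁻¹ ∈ F`. [folklore] -/
@[to_additive]
private theorem inv_mem_of_forall_mul_mem_left {F : Finset G} {d : G} (h1 : (1 : G) ∈ F)
    (h : ∀ f ∈ F, d * f ∈ F) : d⁻¹ ∈ F := by
  have himg : F.image (d * ·) = F := by
    apply eq_of_subset_of_card_le
    · intro x hx
      obtain ⟨f, hf, rfl⟩ := mem_image.1 hx
      exact h f hf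
    · rw [card_image_of_injective _ (mul_right_injective d)]
  have h1' : (1 : G) ∈ F.image (d * ·) := by rw [himg]; exact h1
  obtain ⟨f, hf, hdf⟩ := mem_image.1 h1'
  have : f = d⁻¹ := eq_inv_of_mul_eq_one_right hdf
  rw [← this]
  exact hf

/-- At a terminal pointed pair `(E, F)` the intersection `D = E ∩ F` is (the carrier of) a
subgroup: it contains `1`, is closed under multiplication (`d₁d₂ ∈ E·d₂ ⊆ E`, `d₁d₂ ∈ d₁·F ⊆ F`)
and under inversion (`inv_mem_of_forall_mul_mem_right/left`). [cite: Kemperman1956]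
[cite: DeVos2013, Thm 1.6 (proof step)] -/
@[to_additive]
theorem exists_subgroup_coe_eq_inter {E F : Finset G} (h1E : (1 : G) ∈ E) (h1F : (1 : G) ∈ F)
    (hterm : ∀ d ∈ E, d ∈ F → (∀ e ∈ E, e * d ∈ E) ∧ (∀ f ∈ F, d * f ∈ F)) :
    ∃ H : Subgroup G, (H : Set G) = ↑(E ∩ F) := by
  refine ⟨{ carrier := ↑(E ∩ F)
            mul_mem' := fun {x y} hx hy => ?_
            one_mem' := ?_
            inv_mem' := fun {x} hx => ?_ }, rfl⟩
  · rw [mem_coe, mem_inter] at hx hy ⊢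
    exact ⟨(hterm y hy.1 hy.2).1 x hx.1, (hterm x hx.1 hx.2).2 y hy.2⟩
  · rw [mem_coe, mem_inter]
    exact ⟨h1E, h1F⟩
  · rw [mem_coe, mem_inter] at hx ⊢
    exact ⟨inv_mem_of_forall_mul_mem_right h1E (hterm x hx.1 hx.2).1,
      inv_mem_of_forall_mul_mem_left h1F (hterm x hx.1 hx.2).2⟩

/-- `1 ∈ A ∩ B ⇒ A ∪ B ⊆ A·B` (`a = a·1`, `b = 1·b`). [folklore] -/
@[to_additive]
private theorem union_subset_mul {A B : Finset G} (h1A : (1 : G) ∈ A) (h1B : (1 : G) ∈ B) :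
    A ∪ B ⊆ A * B := by
  intro x hx
  rcases mem_union.1 hx with hxA | hxB
  · exact mem_mul.2 ⟨x, hxA, 1, h1B, mul_one x⟩
  · exact mem_mul.2 ⟨1, h1A, x, hxB, one_mul x⟩

/-- The counting step at a pointed pair: `1 ∈ A ∩ B ⇒ |A| + |B| ≤ |AB| + |A ∩ B|`
(`|A ∪ B| + |A ∩ B| = |A| + |B|` and `A ∪ B ⊆ AB`). [folklore] -/
@[to_additive]
private theorem card_add_card_le_card_mul_add_card_inter {A B : Finset G} (h1A : (1 : G) ∈ A)
    (h1B : (1 : G) ∈ B) : #A + #B ≤ #(A * B) + #(A ∩ B) := by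
  have h := card_union_add_card_inter A B
  have h' : #(A ∪ B) ≤ #(A * B) := card_le_card (union_subset_mul h1A h1B)
  omega

/-! ### The theorem -/

/-- **Kemperman's pointed-subgroup theorem, normalised form** (`1 ∈ A ∩ B`), with the subgroup
as a finite SET: there is `H ⊆ AB` containing `1`, closed under `·` and `⁻¹`, with
`|A| + |B| ≤ |AB| + |H|`.  (`H = E ∩ F` for a terminal pointed pair `(E, F)`:
`H ⊆ F ⊆ EF ⊆ AB` and `|A| + |B| ≤ |E| + |F| ≤ |EF| + |E ∩ F| ≤ |AB| + |H|`.)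
[cite: DeVos2013, Thm 1.6] [cite: Kemperman1956] -/
@[to_additive /-- Additive-notation version of Kemperman's pointed-subgroup theorem, normalised
form with the subgroup as a finite set (statement and sources as for the multiplicative
declaration; DeVos 2013 Thm 1.6, Kemperman 1956). -/]
theorem exists_finsetSubgroup_subset_mul (A B : Finset G) (h1A : (1 : G) ∈ A)
    (h1B : (1 : G) ∈ B) :
    ∃ H : Finset G, H ⊆ A * B ∧ (1 : G) ∈ H ∧ (∀ x ∈ H, ∀ y ∈ H, x * y ∈ H) ∧
      (∀ x ∈ H, x⁻¹ ∈ H) ∧ #A + #B ≤ #(A * B) + #H := by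
  obtain ⟨E, F, h1E, h1F, hEF, hcard, hterm⟩ := exists_pointed_terminal_pair A B h1A h1B
  refine ⟨E ∩ F, ?_, mem_inter.2 ⟨h1E, h1F⟩, fun x hx y hy => ?_, fun x hx => ?_, ?_⟩
  · -- `E ∩ F ⊆ F ⊆ E F ⊆ A B`
    intro x hx
    exact hEF (mem_mul.2 ⟨1, h1E, x, (mem_inter.1 hx).2, one_mul x⟩)
  · rw [mem_inter] at hx hy ⊢
    exact ⟨(hterm y hy.1 hy.2).1 x hx.1, (hterm x hx.1 hx.2).2 y hy.2⟩
  · rw [mem_inter] at hx ⊢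
    exact ⟨inv_mem_of_forall_mul_mem_right h1E (hterm x hx.1 hx.2).1,
      inv_mem_of_forall_mul_mem_left h1F (hterm x hx.1 hx.2).2⟩
  · have h1 := card_add_card_le_card_mul_add_card_inter h1E h1F
    have h2 : #(E * F) ≤ #(A * B) := card_le_card hEF
    omega

/-- **Kemperman's pointed-subgroup theorem, normalised form** (`1 ∈ A ∩ B`), bundled: there is a
finite subgroup `H ≤ G` with `H ⊆ AB` and `|A| + |B| ≤ |AB| + |H|`.
[cite: DeVos2013, Thm 1.6] [cite: Kemperman1956] -/
@[to_additive /-- Additive-notation version of Kemperman's pointed-subgroup theorem, normalised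
bundled form (statement and sources as for the multiplicative declaration; DeVos 2013 Thm 1.6,
Kemperman 1956). -/]
theorem exists_subgroup_subset_mul (A B : Finset G) (h1A : (1 : G) ∈ A) (h1B : (1 : G) ∈ B) :
    ∃ H : Subgroup G, (H : Set G) ⊆ ↑(A * B) ∧ (H : Set G).Finite ∧
      #A + #B ≤ #(A * B) + Nat.card H := by
  obtain ⟨H, hHAB, hH1, hHmul, hHinv, hcard⟩ := exists_finsetSubgroup_subset_mul A B h1A h1B
  let K : Subgroup G :=
    { carrier := ↑H
      mul_mem' := fun {x y} hx hy => by
        rw [mem_coe] at hx hy ⊢; exact hHmul x hx y hy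
      one_mem' := by rw [mem_coe]; exact hH1
      inv_mem' := fun {x} hx => by rw [mem_coe] at hx ⊢; exact hHinv x hx }
  have hKH : (K : Set G) = ↑H := rfl
  have hKcard : Nat.card K = #H := by
    rw [← SetLike.coe_sort_coe, hKH, Nat.card_coe_set_eq, Set.ncard_coe_finset]
  refine ⟨K, ?_, by rw [hKH]; exact H.finite_toSet, by rw [hKcard]; exact hcard⟩
  rw [hKH]
  exact coe_subset.2 hHAB

end KempermanPointed

open KempermanPointed

/-! ### Step 1 — de-normalisation: DeVos 2013, Theorem 1.6 as printed -/

/-- **Kemperman 1956 / DeVos 2013 Theorem 1.6 (the pointed-subgroup theorem).**  "If `A, B ⊆ G`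
are finite and nonempty and `a ∈ A` and `b ∈ B`, there exists `H ≤ G` so that `δ(A,B) ≤ |H|` and
`aHb ⊆ AB`" — with `δ(A,B) = |A| + |B| − |AB|`, i.e. `|A| + |B| ≤ |AB| + |H|`; `H` is finite.
Any group `G`.  Proof: apply the normalised form to `(a⁻¹A, Bb⁻¹)`.
[cite: DeVos2013, Thm 1.6] [cite: Kemperman1956] -/
@[to_additive /-- **Kemperman 1956 / DeVos 2013 Theorem 1.6,
additive notation.**  For finite `A, B` in any additive group and `a ∈ A`, `b ∈ B` there is a
finite subgroup `H` with `|A| + |B| ≤ |A + B| + |H|` and `a + H + b ⊆ A + B` (statement and sources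
as for the multiplicative declaration; DeVos 2013 Thm 1.6, Kemperman 1956). -/]
theorem kemperman_pointed_subgroup {A B : Finset G} {a b : G} (ha : a ∈ A) (hb : b ∈ B) :
    ∃ H : Subgroup G, (H : Set G).Finite ∧ #A + #B ≤ #(A * B) + Nat.card H ∧
      ∀ h ∈ H, a * h * b ∈ A * B := by
  -- normalise: `A' = a⁻¹ A`, `B' = B b⁻¹`
  set A' := A.image (a⁻¹ * ·) with hA'
  set B' := B.image (· * b⁻¹) with hB'
  have h1A' : (1 : G) ∈ A' := mem_image.2 ⟨a, ha, inv_mul_cancel a⟩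
  have h1B' : (1 : G) ∈ B' := mem_image.2 ⟨b, hb, mul_inv_cancel b⟩
  have hcA : #A' = #A := card_image_of_injective _ (mul_right_injective a⁻¹)
  have hcB : #B' = #B := card_image_of_injective _ (mul_left_injective b⁻¹)
  -- `A' B'` is the image of `A B` under `x ↦ a⁻¹ x b⁻¹`
  have hprod : A' * B' = (A * B).image (fun x => a⁻¹ * x * b⁻¹) := by
    ext x
    simp only [hA', hB', mem_mul, mem_image]
    constructor
    · rintro ⟨u, ⟨x, hx, rfl⟩, v, ⟨y, hy, rfl⟩, rfl⟩
      exact ⟨x * y, ⟨x, hx, y, hy, rfl⟩, by simp only [mul_assoc]⟩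
    · rintro ⟨z, ⟨x, hx, y, hy, rfl⟩, rfl⟩
      exact ⟨a⁻¹ * x, ⟨x, hx, rfl⟩, y * b⁻¹, ⟨y, hy, rfl⟩, by simp only [mul_assoc]⟩
  have hinj : Function.Injective (fun x : G => a⁻¹ * x * b⁻¹) := by
    intro x y hxy
    have := mul_left_injective b⁻¹ hxy
    exact mul_right_injective a⁻¹ (by simpa using this)
  have hcAB : #(A' * B') = #(A * B) := by
    rw [hprod, card_image_of_injective _ hinj]
  obtain ⟨H, hHsub, hHfin, hcard⟩ := exists_subgroup_subset_mul A' B' h1A' h1B'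
  refine ⟨H, hHfin, by rw [← hcA, ← hcB, ← hcAB]; exact hcard, fun h hh => ?_⟩
  have hh' : h ∈ A' * B' := by
    have : (h : G) ∈ (H : Set G) := hh
    exact mem_coe.1 (hHsub this)
  rw [hprod, mem_image] at hh'
  obtain ⟨z, hz, rfl⟩ := hh'
  have : a * (a⁻¹ * z * b⁻¹) * b = z := by group
  rw [this]
  exact hz

/-- **The dichotomy behind Kemperman's inequality.**  For finite non-empty `A, B` in any group and
`a ∈ A`, `b ∈ B`: either `|AB| ≥ |A| + |B| − 1`, or `AB` contains the two-sided translate `aHb`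
of a NON-TRIVIAL finite subgroup `H` with `|A| + |B| ≤ |AB| + |H|`.  (For torsion-free `G` the
second branch is void: Kemperman's `|AB| ≥ |A| + |B| − 1`, Brailovsky–Freiman 1990 (1.1); Mathlib:
`Finset.min_le_card_mul` and its torsion-free corollary in `CauchyDavenport.lean`, not restated.)
[cite: DeVos2013, Thm 1.6] [cite: BrailovskyFreiman1990, (1.1)] -/
@[to_additive card_add_card_le_card_add_add_one_or_nontrivial /-- Additive-notation version of the
dichotomy behind Kemperman's inequality (statement and sources as for the multiplicative
declaration; DeVos 2013 Thm 1.6, Brailovsky–Freiman 1990 (1.1)). -/]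
theorem card_add_card_le_card_mul_add_one_or_nontrivial {A B : Finset G} {a b : G} (ha : a ∈ A)
    (hb : b ∈ B) :
    #A + #B ≤ #(A * B) + 1 ∨
      ∃ H : Subgroup G, (H : Set G).Finite ∧ Nontrivial H ∧ #A + #B ≤ #(A * B) + Nat.card H ∧
        ∀ h ∈ H, a * h * b ∈ A * B := by
  obtain ⟨H, hHfin, hcard, hcoset⟩ := kemperman_pointed_subgroup ha hb
  haveI : Finite H := hHfin.to_subtype
  by_cases hH : Nat.card H ≤ 1
  · left
    omega
  · right
    refine ⟨H, hHfin, ?_, hcard, hcoset⟩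
    rw [← Finite.one_lt_card_iff_nontrivial]
    omega

/-! ### The abelian refinement: `H = Stab(AB)` serves every base point (Kneser) -/

section CommGroup

variable {G : Type*} [CommGroup G] [DecidableEq G]

/-- **Kemperman's pointed-subgroup theorem in an ABELIAN group, with the explicit uniform choice
`H = Stab(AB)`:** for finite non-empty `A, B` and any `a ∈ A`, `b ∈ B`,
`|A| + |B| ≤ |AB| + |Stab(AB)|` and `a·Stab(AB)·b ⊆ AB` — the first clause is Kneser's theorem
(weak form, tree `card_add_card_le_card_mul_add_card_mulStab`), the second is the definition of the
stabilizer.  (`Finset.mulStab` is the tree's stabilizer-as-a-finset, `Kneser.lean`.)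
[cite: DeVos2013, Thm 1.6 (abelian case)] [cite: TaoVu2006, Thm 5.5] -/
@[to_additive /-- **Kemperman's pointed-subgroup theorem in an abelian
additive group with `H = Stab(A + B)`:** `|A| + |B| ≤ |A + B| + |Stab(A + B)|` and
`a + Stab(A + B) + b ⊆ A + B` for all `a ∈ A`, `b ∈ B` (Kneser; statement and sources as for the
multiplicative declaration). -/]
theorem kemperman_pointed_mulStab {A B : Finset G} {a b : G} (ha : a ∈ A) (hb : b ∈ B) :
    #A + #B ≤ #(A * B) + #(A * B).mulStab ∧ ∀ h ∈ (A * B).mulStab, a * h * b ∈ A * B := by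
  have hAB : (A * B).Nonempty := ⟨a * b, mul_mem_mul ha hb⟩
  refine ⟨card_add_card_le_card_mul_add_card_mulStab A B ⟨a, ha⟩ ⟨b, hb⟩, fun h hh => ?_⟩
  have hh' := (Finset.mem_mulStab' hAB).1 hh (mul_mem_mul ha hb)
  rw [smul_eq_mul] at hh'
  have : a * h * b = h * (a * b) := by
    rw [mul_comm a h, mul_assoc]
  rw [this]
  exact hh'

end CommGroup

end Literature.Combinatorics.Additive
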